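/-
Copyright (c) 2026 the pub-hodgecm-mathlib formalisation cell (harness21).  Prover seat hodgecm-mathlib-F0P3a-p04 (g30), F3-4 pen under dealer LH4-plan (g8)
(WORD #69 DEAL g8-#19d, route (B) «TOT-Λ BY OVER-ORDERS», gate F3-0 = FIT (LH7-p04 (g11))), heir LEAD F0P3a-plan (g16) T14-66, 2026-09-02∕03.
-/
import Literature.NumberTheory.Rogawski1990.UnitOrbitalIntegralInertSumsTypeTwo            -- ★ `iSixteenM`, `finsum_iSixteenM_eq_phiTHprimeM`, `iSixteenM_eq_zero_of_lt`; brings the ★ closed forms `phiTHM`∕`phiTHprimeM`∕`phiTHn`∕`phiTHprimen`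
import Literature.NumberTheory.Rogawski1990.UnitOrbitalIntegralInertOverOrderSumsTypeTwo    -- ★ LH4-p01 (g9): `overOrderSum_classOne_eq_phiTHM_of_le ∕ _of_lt` (the class-I closed structures = `phiTHM`), the two geometric sums; brings ★ `cast_sub_one_ne_zero`
import HarnessLib

/-!
# The over-order law of the type-(2) unit count summed to Flicker's closed forms: `Σ_b g(b)·Σ_{N″} q^{N″}·H(N″,b) = Φ(t) ∕ Φ′(t″)`

Topic `NumberTheory/Rogawski1990`; namespace `Literature.NumberTheory.Rogawski1990.Flicker1998` (the closed forms' namespace).  THEOREMS ONLY (finite sums in `ℕ`, cast to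
`ℚ`; no definition, no instance, no notation, no named fact, no `sorry`, no `native_decide`); count-neutral; kernel lane `--supports stmt-HodgeConjecture-24833`.  Cell
`pub/hodgecm-mathlib` (D-0151), crux H413; road M6, route (B) «TOT-Λ by over-orders» (dealer LH4-plan (g8) WORD #69 DEAL g8-#19, files F3-1 … F3-5), THIS = F3-4.

THE LAW (F3-0 «ANSATZ CHECK» v1, LH7-p04 (g11), `F0/P3c/LH7/LH7-p04/g11/f3/F3-0-ansatz.v1.LH7p04g11.md` §0.1; law memo LH4-p01 (g9) `…/o4/f3/F3-LAW.v1.LH4p01g9.md`).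
For the type-(2) order `R = O(N, n, φ)` (`N` = conductor of `𝒪_w[g]`, `n = ord χ_g(u)`, `m := v(φ(π_N))` with `n = 2m ≤ 2N` on the even rows and `m ≥ N + 1` on the deep row
`n = 2N + 1`) the number of `γ`-fixed self-dual lattices of class `c ∈ {I, II}` is `TOT_c = Σ_{b ≤ n, b ≡ c (2)} Σ_{N″ ≤ N} w(N″, b)·H(N″, b)`, where `w(N″, 0) = q^{N″}` and
`w(N″, b) = (q+1)q^{N″+b−1}` (`b ≥ 1`) are the torsor sizes of F3-2∕F3-3 and `H(N″, b)` is the number of HERMITIAN, COMPATIBLE characters at the MONOGENIC level `(N″, b)`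
(F3-1b (C1)(C2)(C3)): `H(N″, 0) = 1`; odd `b`: `H = q^{min(N″, N−N″)}` if `b = 2N″+1` and `min(b, N+1) ≤ m`, else `0`; even `b = 2M`, `1 ≤ M ≤ N″`, `k := N − N″`: `H = q^k` if
`M > k` and `m = M + k`, `H = (q−1)q^{M−1}` if `M ≤ k` and `2M ≤ m`, else `0` (and `0` if `M > N″`).  HERE `H` IS ABSTRACT: a function `H : ℕ → ℕ → ℕ` with exactly these
values as HYPOTHESES (`hH0`, `hHeven`, `hHodd`), so that F3-5 instantiates `H N″ b := Nat.card {…}` and discharges them by F3-1b's counting lemmas — nothing is defined here.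
  **`overOrderLawSum_classOne_eq_phiTHn`**: `TOT_I = phiTHn q n N` (= Flicker's `Φ(t)`, ★ `phiTHM` at `M := n∕2` ∕ `N+1`);
  **`overOrderLawSum_classTwo_eq_phiTHprimen`**: `TOT_II = phiTHprimen q n N` (= `Φ′(t″)`, ★ `phiTHprimeM`).
PROOF.  Class II: at an odd level the `N″`-sum is the single term `N″ = (b−1)∕2`, and `b ↦ (b−1)∕2` matches the law term by term with ★ `iSixteenM q M N` (Prop. 16's
per-double-coset values; BOTH of its branches occur, on the deep row), so `TOT_II = Σ_m iSixteenM = phiTHprimeM` by ★ `finsum_iSixteenM_eq_phiTHprimeM` (Prop. 17).  Class I: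
`b = 0` gives `Σ_{N″ ≤ N} q^{N″}`; at `b = 2M` with `2M ≤ m` (or on the deep row) only the window `M ≤ N″ ≤ N − M` of `(q−1)q^{M−1}` survives and sums to
`(q+1)(q^{N+2M−1} − q^{4M−2})` (empty for `2M > N`); at `m < 2M ≤ 2m` the single order `N″ = N + M − m` gives `(q+1)q^{N+2M−1}`; regrouped, this is LH4-p01 (g9)'s closed
structure `(q^{N+1} − 1)∕(q − 1) + (q+1)(Σ_{m′<M} q^{N+2m′+1} − Σ_{m′<⌊M∕2⌋} q^{4m′+2})` (even row `M = m`; deep row both sums to `⌊N∕2⌋`), which ★ LH4-p01 (g9)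
`overOrderSum_classOne_eq_phiTHM_of_le ∕ _of_lt` (`UnitOrbitalIntegralInertOverOrderSumsTypeTwo`) identifies with `phiTHM` in all four parity branches.
ORACLE: `F0/P3a/F0P3a-p04/g30/f34/f34_oracle.py` (exactly these hypotheses' `H`; 520 lawful `(q, N, n, m)` vs the ★-transcribed closed forms: 0 mismatches) and LH7-p04's
`f30_ansatz.py` b8e4d221 (540 + the 46 certified rows).
HONEST LABEL: arithmetic only; pays no organ; zero label movement until F5 ★ + a desk-priced rider; HC_CM is proved only modulo the 7 printed citations (2 remaining named
inputs: hLiu418 = stmt-HodgeConjecture-24832, h413 = stmt-HodgeConjecture-24833) until rung 0 closes.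

## References
* [Flicker1998UnitaryFL] Y. Z. Flicker, *Elementary proof of the fundamental lemma for a unitary group*, Canad. J. Math. 50 (1998), 74–98: Prop. 7 p. 84, Prop. 11 p. 87
  (`Φ(t)`), Props. 16–17 pp. 96–97 (`Φ′(t″)`), Theorem 18 p. 97.
* [Rogawski1990] J. D. Rogawski, *Automorphic Representations of Unitary Groups in Three Variables*, Ann. of Math. Stud. 123 (1990): §4.9 Prop. 4.9.1 (b) p. 55, Lemma
  4.9.3 p. 56.
-/

set_option autoImplicit false

open Finset

namespace Literature.NumberTheory.Rogawski1990.Flicker1998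

variable {q : ℕ}

/-! ## §1 Parity reindexing of the level sum -/

/-- The even levels `b ≤ n` are `b = 2M`, `M ≤ n ∕ 2` (the class-I levels of the law). [cite: Flicker1998UnitaryFL, Prop. 11 p. 87; Prop. 17 p. 97] -/
theorem filter_range_succ_mod_two_eq_zero (n : ℕ) :
    (range (n + 1)).filter (fun b => b % 2 = 0) =
      (range (n / 2 + 1)).map ⟨fun M => 2 * M, fun a b h => by simp only at h; omega⟩ := by
  ext b
  simp only [mem_filter, mem_range, mem_map, Function.Embedding.coeFn_mk]
  constructor
  · rintro ⟨hb, he⟩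
    exact ⟨b / 2, by omega, by omega⟩
  · rintro ⟨M, hM, rfl⟩
    omega

/-- Reindexing a sum over the even levels `b ≤ n` by `b = 2M`. [cite: Flicker1998UnitaryFL, Prop. 11 p. 87; Prop. 17 p. 97] -/
theorem sum_filter_range_succ_even {α : Type*} [AddCommMonoid α] (n : ℕ) (f : ℕ → α) :
    ∑ b ∈ (range (n + 1)).filter (fun b => b % 2 = 0), f b = ∑ M ∈ range (n / 2 + 1), f (2 * M) := by
  rw [filter_range_succ_mod_two_eq_zero, sum_map]
  rfl

/-- The odd levels `b ≤ n` are `b = 2M + 1`, `M < (n+1) ∕ 2` (the class-II levels of the law). [cite: Flicker1998UnitaryFL, Prop. 16 p. 96; Prop. 17 p. 97] -/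
theorem filter_range_succ_mod_two_eq_one (n : ℕ) :
    (range (n + 1)).filter (fun b => b % 2 = 1) =
      (range ((n + 1) / 2)).map ⟨fun M => 2 * M + 1, fun a b h => by simp only at h; omega⟩ := by
  ext b
  simp only [mem_filter, mem_range, mem_map, Function.Embedding.coeFn_mk]
  constructor
  · rintro ⟨hb, ho⟩
    exact ⟨b / 2, by omega, by omega⟩
  · rintro ⟨M, hM, rfl⟩
    omega

/-- Reindexing a sum over the odd levels `b ≤ n` by `b = 2M + 1`. [cite: Flicker1998UnitaryFL, Prop. 16 p. 96; Prop. 17 p. 97] -/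
theorem sum_filter_range_succ_odd {α : Type*} [AddCommMonoid α] (n : ℕ) (f : ℕ → α) :
    ∑ b ∈ (range (n + 1)).filter (fun b => b % 2 = 1), f b = ∑ M ∈ range ((n + 1) / 2), f (2 * M + 1) := by
  rw [filter_range_succ_mod_two_eq_one, sum_map]
  rfl

/-! ## §2 The inner (`N″`-) sums of the law -/

/-- Level `b = 0`: `H = 1`, the inner sum is `Σ_{N″ ≤ N} q^{N″}` (the product orders `𝒪_{N″} × 𝒪_w`). [cite: Flicker1998UnitaryFL, Prop. 7 p. 84; Prop. 11 p. 87] [cite: Rogawski1990, §4.9 Prop. 4.9.1 (b) p. 55] -/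
theorem lawInner_zero {N : ℕ} (H : ℕ → ℕ → ℕ) (hH0 : ∀ N'' ≤ N, H N'' 0 = 1) :
    ∑ N'' ∈ range (N + 1), (if 2 * 0 = 0 then q ^ N'' else (q + 1) * q ^ (N'' + 2 * 0 - 1)) * H N'' (2 * 0) =
      ∑ N'' ∈ range (N + 1), q ^ N'' := by
  refine Finset.sum_congr rfl fun N'' hN'' => ?_
  rw [if_pos rfl, Nat.mul_zero, hH0 N'' (by have := mem_range.1 hN''; omega), mul_one]

/-- Odd level `b = 2M + 1 ≤ n`: the inner sum is the single term `N″ = M` — `(q+1)·q^{3M + min(M, N−M)}` if `M ≤ N` and `min(b, N+1) ≤ m`, else `0` (Prop. 16's `m`-th value). [cite: Flicker1998UnitaryFL, Prop. 16 p. 96; Prop. 17 p. 97] -/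
theorem lawInner_odd {N n m : ℕ} (H : ℕ → ℕ → ℕ)
    (hHodd : ∀ N'' ≤ N, ∀ b ≤ n, b % 2 = 1 →
      H N'' b = if b = 2 * N'' + 1 ∧ min b (N + 1) ≤ m then q ^ min N'' (N - N'') else 0)
    {M : ℕ} (hM : 2 * M + 1 ≤ n) :
    ∑ N'' ∈ range (N + 1), (if 2 * M + 1 = 0 then q ^ N'' else (q + 1) * q ^ (N'' + (2 * M + 1) - 1)) * H N'' (2 * M + 1) =
      if M ≤ N ∧ min (2 * M + 1) (N + 1) ≤ m then (q + 1) * q ^ (3 * M + min M (N - M)) else 0 := by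
  by_cases hMN : M ≤ N
  · rw [Finset.sum_eq_single_of_mem M (mem_range.2 (by omega))]
    · rw [if_neg (show ¬ (2 * M + 1 = 0) by omega), hHodd M hMN _ hM (by omega), show M + (2 * M + 1) - 1 = 3 * M by omega]
      by_cases hc : min (2 * M + 1) (N + 1) ≤ m
      · rw [if_pos ⟨rfl, hc⟩, if_pos ⟨hMN, hc⟩, pow_add, mul_assoc]
      · rw [if_neg (fun h => hc h.2), if_neg (fun h => hc h.2), mul_zero]
    · intro N'' hN'' hne
      rw [if_neg (show ¬ (2 * M + 1 = 0) by omega), hHodd N'' (by have := mem_range.1 hN''; omega) _ hM (by omega),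
        if_neg (show ¬ (2 * M + 1 = 2 * N'' + 1 ∧ min (2 * M + 1) (N + 1) ≤ m) from fun h => hne (by omega)), mul_zero]
  · rw [if_neg (fun h => hMN h.1)]
    refine Finset.sum_eq_zero fun N'' hN'' => ?_
    have hN''N : N'' ≤ N := by have := mem_range.1 hN''; omega
    rw [if_neg (show ¬ (2 * M + 1 = 0) by omega), hHodd N'' hN''N _ hM (by omega),
      if_neg (show ¬ (2 * M + 1 = 2 * N'' + 1 ∧ min (2 * M + 1) (N + 1) ≤ m) from fun h => hMN (by omega)), mul_zero]

/-- Even level `b = 2(M+1) ≤ n` in the WINDOW regime (`2(M+1) ≤ m`, or the deep row `N + 1 ≤ m`): only the orders `M+1 ≤ N″ ≤ N − (M+1)` carry characters,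
`(q−1)q^M` each, and the inner sum is `(q+1)(q^{N+2M+1} − q^{4M+2})` if `2(M+1) ≤ N`, else `0` (empty window). [cite: Flicker1998UnitaryFL, Prop. 7 p. 84; Prop. 11 p. 87] [cite: Rogawski1990, §4.9 Prop. 4.9.1 (b) p. 55] -/
theorem lawInner_even_window (hq : 1 < q) {N n m : ℕ} (H : ℕ → ℕ → ℕ)
    (hHeven : ∀ N'' ≤ N, ∀ M, 1 ≤ M → 2 * M ≤ n →
      H N'' (2 * M) = if M ≤ N'' then
        (if N - N'' < M ∧ m = M + (N - N'') then q ^ (N - N'')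
          else if M ≤ N - N'' ∧ 2 * M ≤ m then (q - 1) * q ^ (M - 1) else 0) else 0)
    {M : ℕ} (hMn : 2 * (M + 1) ≤ n) (hkill : 2 * (M + 1) ≤ m ∨ N + 1 ≤ m) :
    (((∑ N'' ∈ range (N + 1), (if 2 * (M + 1) = 0 then q ^ N'' else (q + 1) * q ^ (N'' + 2 * (M + 1) - 1)) * H N'' (2 * (M + 1)) : ℕ)) : ℚ) =
      if 2 * (M + 1) ≤ N then ((q : ℚ) + 1) * ((q : ℚ) ^ (N + 2 * M + 1) - (q : ℚ) ^ (4 * M + 2)) else 0 := by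
  have hterm : ∀ N'' ∈ range (N + 1),
      (if 2 * (M + 1) = 0 then q ^ N'' else (q + 1) * q ^ (N'' + 2 * (M + 1) - 1)) * H N'' (2 * (M + 1)) =
        if M + 1 ≤ N'' ∧ N'' + (M + 1) ≤ N then (q + 1) * (q - 1) * q ^ (N'' + 3 * M + 1) else 0 := by
    intro N'' hN''
    have hN''N : N'' ≤ N := by have := mem_range.1 hN''; omega
    rw [if_neg (show ¬ (2 * (M + 1) = 0) by omega), hHeven N'' hN''N (M + 1) (by omega) hMn]
    by_cases hW : M + 1 ≤ N'' ∧ N'' + (M + 1) ≤ N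
    · rw [if_pos hW.1, if_neg (show ¬ (N - N'' < M + 1 ∧ m = M + 1 + (N - N'')) by omega),
        if_pos (show M + 1 ≤ N - N'' ∧ 2 * (M + 1) ≤ m by omega), if_pos hW, show M + 1 - 1 = M by omega,
        show N'' + 2 * (M + 1) - 1 = N'' + 2 * M + 1 by omega]
      ring
    · rw [if_neg hW]
      by_cases h1 : M + 1 ≤ N''
      · rw [if_pos h1, if_neg (show ¬ (N - N'' < M + 1 ∧ m = M + 1 + (N - N'')) by omega),
          if_neg (show ¬ (M + 1 ≤ N - N'' ∧ 2 * (M + 1) ≤ m) by omega), mul_zero]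
      · rw [if_neg h1, mul_zero]
  rw [Finset.sum_congr rfl hterm, ← Finset.sum_filter]
  by_cases h2N : 2 * (M + 1) ≤ N
  · rw [if_pos h2N]
    obtain ⟨K, rfl⟩ : ∃ K, N = 2 * (M + 1) + K := ⟨N - 2 * (M + 1), by omega⟩
    have hfilt : (range (2 * (M + 1) + K + 1)).filter (fun N'' => M + 1 ≤ N'' ∧ N'' + (M + 1) ≤ 2 * (M + 1) + K) = Ico (M + 1) (M + 1 + K + 1) := by
      ext N''
      simp only [mem_filter, mem_range, mem_Ico]
      omega
    rw [hfilt]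
    push_cast [Nat.cast_sub (le_of_lt hq)]
    have hq1 : (q : ℚ) ≠ 1 := by exact_mod_cast (ne_of_gt hq)
    have hfac : ∑ x ∈ Ico (M + 1) (M + 1 + K + 1), ((q : ℚ) + 1) * ((q : ℚ) - 1) * (q : ℚ) ^ (x + 3 * M + 1) =
        ((q : ℚ) + 1) * ((q : ℚ) - 1) * (q : ℚ) ^ (3 * M + 1) * ∑ x ∈ Ico (M + 1) (M + 1 + K + 1), (q : ℚ) ^ x := by
      rw [Finset.mul_sum]
      exact Finset.sum_congr rfl fun x _ => by ring
    rw [hfac, geom_sum_Ico hq1 (by omega), show 2 * (M + 1) + K + 2 * M + 1 = (M + 1 + K + 1) + (3 * M + 1) by omega,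
      show 4 * M + 2 = (M + 1) + (3 * M + 1) by omega, pow_add, pow_add]
    have h1 := cast_sub_one_ne_zero hq
    field_simp
    ring
  · rw [if_neg h2N]
    have hfilt : (range (N + 1)).filter (fun N'' => M + 1 ≤ N'' ∧ N'' + (M + 1) ≤ N) = ∅ := by
      ext N''
      simp only [mem_filter, mem_range, Finset.notMem_empty, iff_false, not_and]
      omega
    rw [hfilt, Finset.sum_empty, Nat.cast_zero]

/-- Even level `b = 2(M+1) ≤ n` in the SINGLE-ORDER regime of an even row (`m < 2(M+1)`, `M + 1 ≤ m ≤ N`): only `N″ = N + (M+1) − m` carries characters, `q^{N−N″}` of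
them, and the inner sum is `(q+1)q^{N+2M+1}`. [cite: Flicker1998UnitaryFL, Prop. 7 p. 84; Prop. 11 p. 87] [cite: Rogawski1990, §4.9 Prop. 4.9.1 (b) p. 55] -/
theorem lawInner_even_single {N n m : ℕ} (H : ℕ → ℕ → ℕ)
    (hHeven : ∀ N'' ≤ N, ∀ M, 1 ≤ M → 2 * M ≤ n →
      H N'' (2 * M) = if M ≤ N'' then
        (if N - N'' < M ∧ m = M + (N - N'') then q ^ (N - N'')
          else if M ≤ N - N'' ∧ 2 * M ≤ m then (q - 1) * q ^ (M - 1) else 0) else 0)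
    {M : ℕ} (hMn : 2 * (M + 1) ≤ n) (hmM : m < 2 * (M + 1)) (hMm : M + 1 ≤ m) (hmN : m ≤ N) :
    ∑ N'' ∈ range (N + 1), (if 2 * (M + 1) = 0 then q ^ N'' else (q + 1) * q ^ (N'' + 2 * (M + 1) - 1)) * H N'' (2 * (M + 1)) =
      (q + 1) * q ^ (N + 2 * M + 1) := by
  obtain ⟨a, rfl⟩ : ∃ a, m = M + 1 + a := ⟨m - (M + 1), by omega⟩
  obtain ⟨c, rfl⟩ : ∃ c, N = M + 1 + a + c := ⟨N - (M + 1 + a), by omega⟩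
  rw [Finset.sum_eq_single_of_mem (M + 1 + c) (mem_range.2 (by omega))]
  · rw [if_neg (show ¬ (2 * (M + 1) = 0) by omega), hHeven _ (by omega) (M + 1) (by omega) hMn, if_pos (show M + 1 ≤ M + 1 + c by omega),
      show M + 1 + a + c - (M + 1 + c) = a by omega, if_pos (show a < M + 1 ∧ M + 1 + a = M + 1 + a by omega),
      show M + 1 + c + 2 * (M + 1) - 1 = 3 * M + 2 + c by omega, show M + 1 + a + c + 2 * M + 1 = (3 * M + 2 + c) + a by omega, pow_add]
    ring
  · intro N'' hN'' hne
    have hN''N : N'' ≤ M + 1 + a + c := by have := mem_range.1 hN''; omega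
    rw [if_neg (show ¬ (2 * (M + 1) = 0) by omega), hHeven N'' hN''N (M + 1) (by omega) hMn]
    by_cases h1 : M + 1 ≤ N''
    · rw [if_pos h1, if_neg (show ¬ (M + 1 + a + c - N'' < M + 1 ∧ M + 1 + a = M + 1 + (M + 1 + a + c - N'')) by omega),
        if_neg (show ¬ (M + 1 ≤ M + 1 + a + c - N'' ∧ 2 * (M + 1) ≤ M + 1 + a) by omega), mul_zero]
    · rw [if_neg h1, mul_zero]

/-! ## §3 The row totals of class I over the levels `b = 2, 4, …` -/

/-- EVEN ROW `n = 2m`, `1 ≤ m ≤ N`: `Σ_{M < m} (inner sum at b = 2(M+1)) = (q+1)·(Σ_{M<m} q^{N+2M+1} − Σ_{M<⌊m∕2⌋} q^{4M+2})` (Prop. 11's two geometric sums). [cite: Flicker1998UnitaryFL, Prop. 7 p. 84; Prop. 11 p. 87] [cite: Rogawski1990, §4.9 Prop. 4.9.1 (b) p. 55] -/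
theorem lawRow_classOne_even (hq : 1 < q) {N m : ℕ} (H : ℕ → ℕ → ℕ)
    (hHeven : ∀ N'' ≤ N, ∀ M, 1 ≤ M → 2 * M ≤ 2 * m →
      H N'' (2 * M) = if M ≤ N'' then
        (if N - N'' < M ∧ m = M + (N - N'') then q ^ (N - N'')
          else if M ≤ N - N'' ∧ 2 * M ≤ m then (q - 1) * q ^ (M - 1) else 0) else 0)
    (hm1 : 1 ≤ m) (hmN : m ≤ N) :
    ∑ M ∈ range m, (((∑ N'' ∈ range (N + 1),
        (if 2 * (M + 1) = 0 then q ^ N'' else (q + 1) * q ^ (N'' + 2 * (M + 1) - 1)) * H N'' (2 * (M + 1)) : ℕ)) : ℚ) =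
      ((q : ℚ) + 1) * (∑ M ∈ range m, (q : ℚ) ^ (N + 2 * M + 1) - ∑ M ∈ range (m / 2), (q : ℚ) ^ (4 * M + 2)) := by
  have hsplit := (Finset.sum_Ico_consecutive (fun M => (((∑ N'' ∈ range (N + 1),
        (if 2 * (M + 1) = 0 then q ^ N'' else (q + 1) * q ^ (N'' + 2 * (M + 1) - 1)) * H N'' (2 * (M + 1)) : ℕ)) : ℚ))
      (Nat.zero_le (m / 2)) (Nat.div_le_self m 2)).symm
  have hsplitA := (Finset.sum_Ico_consecutive (fun M => (q : ℚ) ^ (N + 2 * M + 1)) (Nat.zero_le (m / 2)) (Nat.div_le_self m 2)).symm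
  rw [Finset.range_eq_Ico m, Finset.range_eq_Ico (m / 2), hsplit, hsplitA]
  have hpart1 : ∑ M ∈ Ico 0 (m / 2), (((∑ N'' ∈ range (N + 1),
        (if 2 * (M + 1) = 0 then q ^ N'' else (q + 1) * q ^ (N'' + 2 * (M + 1) - 1)) * H N'' (2 * (M + 1)) : ℕ)) : ℚ) =
      ∑ M ∈ Ico 0 (m / 2), ((q : ℚ) + 1) * ((q : ℚ) ^ (N + 2 * M + 1) - (q : ℚ) ^ (4 * M + 2)) := by
    refine Finset.sum_congr rfl fun M hM => ?_
    have hM' : M < m / 2 := (mem_Ico.1 hM).2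
    rw [lawInner_even_window hq H hHeven (by omega) (Or.inl (by omega)), if_pos (by omega)]
  have hpart2 : ∑ M ∈ Ico (m / 2) m, (((∑ N'' ∈ range (N + 1),
        (if 2 * (M + 1) = 0 then q ^ N'' else (q + 1) * q ^ (N'' + 2 * (M + 1) - 1)) * H N'' (2 * (M + 1)) : ℕ)) : ℚ) =
      ∑ M ∈ Ico (m / 2) m, ((q : ℚ) + 1) * (q : ℚ) ^ (N + 2 * M + 1) := by
    refine Finset.sum_congr rfl fun M hM => ?_
    have hM' : m / 2 ≤ M ∧ M < m := mem_Ico.1 hM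
    rw [lawInner_even_single H hHeven (by omega) (by omega) (by omega) hmN]
    push_cast
    ring
  rw [hpart1, hpart2]
  simp only [mul_sub, Finset.sum_sub_distrib, ← Finset.mul_sum]
  ring

/-- DEEP ROW `n = 2N+1`, `N + 1 ≤ m`: `Σ_{M < N} (inner sum at b = 2(M+1)) = (q+1)·(Σ_{M<⌊N∕2⌋} q^{N+2M+1} − Σ_{M<⌊N∕2⌋} q^{4M+2})` (the levels `2(M+1) > N` are empty). [cite: Flicker1998UnitaryFL, Prop. 7 p. 84; Prop. 11 p. 87] [cite: Rogawski1990, §4.9 Prop. 4.9.1 (b) p. 55] -/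
theorem lawRow_classOne_deep (hq : 1 < q) {N m : ℕ} (H : ℕ → ℕ → ℕ)
    (hHeven : ∀ N'' ≤ N, ∀ M, 1 ≤ M → 2 * M ≤ 2 * N + 1 →
      H N'' (2 * M) = if M ≤ N'' then
        (if N - N'' < M ∧ m = M + (N - N'') then q ^ (N - N'')
          else if M ≤ N - N'' ∧ 2 * M ≤ m then (q - 1) * q ^ (M - 1) else 0) else 0)
    (hNm : N + 1 ≤ m) :
    ∑ M ∈ range N, (((∑ N'' ∈ range (N + 1),
        (if 2 * (M + 1) = 0 then q ^ N'' else (q + 1) * q ^ (N'' + 2 * (M + 1) - 1)) * H N'' (2 * (M + 1)) : ℕ)) : ℚ) =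
      ((q : ℚ) + 1) * (∑ M ∈ range (N / 2), (q : ℚ) ^ (N + 2 * M + 1) - ∑ M ∈ range (N / 2), (q : ℚ) ^ (4 * M + 2)) := by
  have hsplit := (Finset.sum_Ico_consecutive (fun M => (((∑ N'' ∈ range (N + 1),
        (if 2 * (M + 1) = 0 then q ^ N'' else (q + 1) * q ^ (N'' + 2 * (M + 1) - 1)) * H N'' (2 * (M + 1)) : ℕ)) : ℚ))
      (Nat.zero_le (N / 2)) (Nat.div_le_self N 2)).symm
  rw [Finset.range_eq_Ico N, Finset.range_eq_Ico (N / 2), hsplit]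
  have hpart1 : ∑ M ∈ Ico 0 (N / 2), (((∑ N'' ∈ range (N + 1),
        (if 2 * (M + 1) = 0 then q ^ N'' else (q + 1) * q ^ (N'' + 2 * (M + 1) - 1)) * H N'' (2 * (M + 1)) : ℕ)) : ℚ) =
      ∑ M ∈ Ico 0 (N / 2), ((q : ℚ) + 1) * ((q : ℚ) ^ (N + 2 * M + 1) - (q : ℚ) ^ (4 * M + 2)) := by
    refine Finset.sum_congr rfl fun M hM => ?_
    have hM' : M < N / 2 := (mem_Ico.1 hM).2
    rw [lawInner_even_window hq H hHeven (by omega) (Or.inr hNm), if_pos (by omega)]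
  have hpart2 : ∑ M ∈ Ico (N / 2) N, (((∑ N'' ∈ range (N + 1),
        (if 2 * (M + 1) = 0 then q ^ N'' else (q + 1) * q ^ (N'' + 2 * (M + 1) - 1)) * H N'' (2 * (M + 1)) : ℕ)) : ℚ) = 0 := by
    refine Finset.sum_eq_zero fun M hM => ?_
    have hM' : N / 2 ≤ M ∧ M < N := mem_Ico.1 hM
    rw [lawInner_even_window hq H hHeven (by omega) (Or.inr hNm), if_neg (by omega)]
  rw [hpart1, hpart2, add_zero]
  simp only [mul_sub, Finset.sum_sub_distrib, ← Finset.mul_sum]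

/-! ## §4 F3-4: the law sums equal Flicker's closed forms -/

/-- **F3-4 (I).**  The over-order law summed over the class-I levels (`b` even, `b ≤ n`) equals Flicker's `Φ(t) = phiTHn q n N`, on every lawful row (`n = 2m`,
`1 ≤ m ≤ N`, `m = v(φ(π_N))`; or the deep row `n = 2N+1` with `v(φ(π_N)) ≥ N+1`), for ANY function `H` with the values of F3-1b (C2)(C3) (hermitian compatible characters
at the monogenic even levels).  [cite: Flicker1998UnitaryFL, Prop. 11 p. 87; Theorem 18 p. 97] [cite: Rogawski1990, §4.9 Prop. 4.9.1 (b) p. 55] -/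
theorem overOrderLawSum_classOne_eq_phiTHn (hq : 1 < q) {N n m : ℕ}
    (hlaw : (n = 2 * m ∧ 1 ≤ m ∧ m ≤ N) ∨ (n = 2 * N + 1 ∧ N + 1 ≤ m))
    (H : ℕ → ℕ → ℕ) (hH0 : ∀ N'' ≤ N, H N'' 0 = 1)
    (hHeven : ∀ N'' ≤ N, ∀ M, 1 ≤ M → 2 * M ≤ n →
      H N'' (2 * M) = if M ≤ N'' then
        (if N - N'' < M ∧ m = M + (N - N'') then q ^ (N - N'')
          else if M ≤ N - N'' ∧ 2 * M ≤ m then (q - 1) * q ^ (M - 1) else 0) else 0) :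
    (((∑ b ∈ (range (n + 1)).filter (fun b => b % 2 = 0), ∑ N'' ∈ range (N + 1),
        (if b = 0 then q ^ N'' else (q + 1) * q ^ (N'' + b - 1)) * H N'' b : ℕ)) : ℚ) = phiTHn q n N := by
  have hq1 : (q : ℚ) ≠ 1 := by exact_mod_cast (ne_of_gt hq)
  rcases hlaw with ⟨rfl, hm1, hmN⟩ | ⟨rfl, hNm⟩
  · -- even row `n = 2m`
    rw [sum_filter_range_succ_even, show 2 * m / 2 + 1 = m + 1 by omega, Finset.sum_range_succ', lawInner_zero H hH0,
      Nat.cast_add, Nat.cast_sum, lawRow_classOne_even hq H hHeven hm1 hmN, Nat.cast_sum]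
    simp only [Nat.cast_pow]
    rw [geom_sum_eq hq1 (N + 1), add_comm, overOrderSum_classOne_eq_phiTHM_of_le hq hmN, phiTHn, if_pos (Nat.mul_mod_right 2 m),
      Nat.mul_div_cancel_left m two_pos]
  · -- deep row `n = 2N + 1`
    rw [sum_filter_range_succ_even, show (2 * N + 1) / 2 + 1 = N + 1 by omega, Finset.sum_range_succ', lawInner_zero H hH0,
      Nat.cast_add, Nat.cast_sum, lawRow_classOne_deep hq H hHeven hNm, Nat.cast_sum]
    simp only [Nat.cast_pow]
    rw [geom_sum_eq hq1 (N + 1), add_comm, overOrderSum_classOne_eq_phiTHM_of_lt hq (Nat.lt_succ_self N), phiTHn, if_neg (by omega)]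

/-- **F3-4 (II).**  The over-order law summed over the class-II levels (`b` odd, `b ≤ n`) equals Flicker's `Φ′(t″) = phiTHprimen q n N`, on every lawful row, for ANY
function `H` with the values of F3-1b (C1) (hermitian compatible characters at the monogenic odd levels `b = 2N″+1`).  Term by term the law is Prop. 16's table
`iSixteenM` (both branches occur on the deep row), and the sum is Prop. 17 (★ `finsum_iSixteenM_eq_phiTHprimeM`).
[cite: Flicker1998UnitaryFL, Props. 16–17 pp. 96–97; Theorem 18 p. 97] [cite: Rogawski1990, §4.9 Prop. 4.9.1 (b) p. 55] -/
theorem overOrderLawSum_classTwo_eq_phiTHprimen (hq : 1 < q) {N n m : ℕ}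
    (hlaw : (n = 2 * m ∧ 1 ≤ m ∧ m ≤ N) ∨ (n = 2 * N + 1 ∧ N + 1 ≤ m))
    (H : ℕ → ℕ → ℕ)
    (hHodd : ∀ N'' ≤ N, ∀ b ≤ n, b % 2 = 1 →
      H N'' b = if b = 2 * N'' + 1 ∧ min b (N + 1) ≤ m then q ^ min N'' (N - N'') else 0) :
    (((∑ b ∈ (range (n + 1)).filter (fun b => b % 2 = 1), ∑ N'' ∈ range (N + 1),
        (if b = 0 then q ^ N'' else (q + 1) * q ^ (N'' + b - 1)) * H N'' b : ℕ)) : ℚ) = phiTHprimen q n N := by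
  -- the level sum, reindexed by `b = 2M + 1`, is `Σ_{M < (n+1)/2} iSixteenM q M₀ N M` with `M₀ := n/2` (even row) ∕ `N + 1` (deep row)
  rw [sum_filter_range_succ_odd]
  rw [Finset.sum_congr rfl fun M hM => lawInner_odd H hHodd (M := M) (by have := mem_range.1 hM; omega)]
  have key : ∀ M₀ : ℕ, (M₀ = if n % 2 = 0 then n / 2 else N + 1) →
      (((∑ M ∈ range ((n + 1) / 2), (if M ≤ N ∧ min (2 * M + 1) (N + 1) ≤ m then (q + 1) * q ^ (3 * M + min M (N - M)) else 0) : ℕ)) : ℚ) =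
        ∑ᶠ M : ℕ, iSixteenM q M₀ N M := by
    intro M₀ hM₀
    have hsupp : Function.support (fun M => iSixteenM q M₀ N M) ⊆ ((range ((n + 1) / 2) : Finset ℕ) : Set ℕ) := by
      intro M hM
      rw [Function.mem_support] at hM
      rw [Finset.coe_range, Set.mem_Iio]
      by_contra h
      apply hM
      unfold iSixteenM
      rcases hlaw with ⟨rfl, hm1, hmN⟩ | ⟨rfl, hNm⟩
      · rw [if_pos (Nat.mul_mod_right 2 m), Nat.mul_div_cancel_left m two_pos] at hM₀
        rw [hM₀, if_neg (show ¬ (1 ≤ m ∧ M ≤ min (N / 2) ((m - 1) / 2)) by omega), if_neg (show ¬ (N < m ∧ N / 2 < M ∧ M ≤ N) by omega)]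
      · rw [if_neg (show ¬ ((2 * N + 1) % 2 = 0) by omega)] at hM₀
        rw [hM₀, Nat.add_sub_cancel, if_neg (show ¬ (1 ≤ N + 1 ∧ M ≤ min (N / 2) (N / 2)) by omega),
          if_neg (show ¬ (N < N + 1 ∧ N / 2 < M ∧ M ≤ N) by omega)]
    rw [finsum_eq_sum_of_support_subset _ hsupp, Nat.cast_sum]
    refine Finset.sum_congr rfl fun M hM => ?_
    have hMr : M < (n + 1) / 2 := mem_range.1 hM
    push_cast
    unfold iSixteenM
    rcases hlaw with ⟨rfl, hm1, hmN⟩ | ⟨rfl, hNm⟩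
    · rw [if_pos (Nat.mul_mod_right 2 m), Nat.mul_div_cancel_left m two_pos] at hM₀
      rw [hM₀]
      by_cases hA : 2 * M + 1 ≤ m
      · rw [if_pos (show M ≤ N ∧ min (2 * M + 1) (N + 1) ≤ m by omega), if_pos (show 1 ≤ m ∧ M ≤ min (N / 2) ((m - 1) / 2) by omega),
          show 3 * M + min M (N - M) = 4 * M by omega]
      · rw [if_neg (show ¬ (M ≤ N ∧ min (2 * M + 1) (N + 1) ≤ m) by omega), if_neg (show ¬ (1 ≤ m ∧ M ≤ min (N / 2) ((m - 1) / 2)) by omega),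
          if_neg (show ¬ (N < m ∧ N / 2 < M ∧ M ≤ N) by omega)]
    · rw [if_neg (show ¬ ((2 * N + 1) % 2 = 0) by omega)] at hM₀
      rw [hM₀, Nat.add_sub_cancel]
      by_cases hA : 2 * M ≤ N
      · rw [if_pos (show M ≤ N ∧ min (2 * M + 1) (N + 1) ≤ m by omega), if_pos (show 1 ≤ N + 1 ∧ M ≤ min (N / 2) (N / 2) by omega),
          show 3 * M + min M (N - M) = 4 * M by omega]
      · rw [if_pos (show M ≤ N ∧ min (2 * M + 1) (N + 1) ≤ m by omega), if_neg (show ¬ (1 ≤ N + 1 ∧ M ≤ min (N / 2) (N / 2)) by omega),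
          if_pos (show N < N + 1 ∧ N / 2 < M ∧ M ≤ N by omega), show 3 * M + min M (N - M) = N + 2 * M by omega]
  rw [key _ rfl, finsum_iSixteenM_eq_phiTHprimeM hq, phiTHprimen]

end Literature.NumberTheory.Rogawski1990.Flicker1998
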